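import Literature.AlgebraicGeometry.HodgeTheory.PicardLefschetzNodalForms
import Literature.AlgebraicGeometry.HodgeTheory.UniversalHypersurfaceDiscriminantBranches
import Literature.AlgebraicGeometry.HodgeTheory.CyclicCoverMeridianMonodromy
import Literature.AlgebraicGeometry.HodgeTheory.CyclicCoverBaseChart
import Literature.AlgebraicGeometry.FundamentalGroup.HypersurfaceComplementMeridiansConj
import Literature.AlgebraicGeometry.FundamentalGroup.HypersurfaceComplementMeridiansGenerate
import HarnessLib

/-!
# A uninodal ternary form of every degree `p ≥ 3` and the singular coefficient vectors of plane curves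
# (towards Carlson–Toledo 1999, §6: the local monodromy at a one-nodal branch curve)

J. A. Carlson, D. Toledo, *Discriminant complements and kernels of monodromy representations*, Duke Math. J. 97 (1999), §1
(«a smooth point `c` of the discriminant locus. For these `X_c` has exactly one node») and §6 (the degeneration (kdoublept));
C. Voisin, *Hodge Theory and Complex Algebraic Geometry II* (2003), §2.3.1.  First file of the Literature-side proof of the named
fact `HodgeTheory.carlsonToledo1999_nodalMeridianLocalMonodromyBound` (`HodgeTheory/CyclicCoverNodalMeridianLocalMonodromyBound`;
apex in `HodgeTheory/CyclicCoverNodalMeridianLocalMonodromyBoundHolds`).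

* Part 1 (namespace `…CyclicCoverMonodromy.UninodalTernaryForm`) — for every `m : ℕ` the ternary form of degree `m + 3`
  `f_m = x₂^{m+1} · x₀ x₁ + x₀^{m+3} + x₁^{m+3}` has EXACTLY ONE singular point in `ℙ²`, the ordinary double point `e₂ = [0:0:1]`
  (`isNodalFormWithNodes_nodalTernaryForm`: `IsNodalFormWithNodes f_m ![e₂]` of `HodgeTheory/PicardLefschetzNodalForms`): the
  gradient is `∂₀ f = x₂^{m+1} x₁ + (m+3) x₀^{m+2}`, `∂₁ f = x₂^{m+1} x₀ + (m+3) x₁^{m+2}`, `∂₂ f = (m+1) x₂^m x₀ x₁`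
  (`pderiv_nodalTernaryForm`); at a zero `z` of the gradient `z = z₂ • e₂` (`eq_smul_of_grad_nodalTernaryForm`); the Hessian at
  `e₂` has rank `2` (`rank_hessian_nodalTernaryForm`, `isOrdinaryDoublePointOf_nodalTernaryForm`); homogeneity
  (`isHomogeneous_nodalTernaryForm`);
* Part 2 (namespace `…CyclicCoverMonodromy.NodalMeridianExists`) — the tree's `formOfCoeffs` for plane curves of degree `p` as
  the ternary form `Σ_e b_e x^e` (`formOfCoeffs_eq_sum`), membership in the singular coefficient set read through an irreducible
  discriminant equation (`mem_singularCoeffs_iff_of_isDiscriminantEquation`), and the coefficient vector of a uninodal form lies in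
  it (`coeffsOf_mem_singularCoeffs_of_uninodal`).

Theorems only: no definition, no named fact.

Provenance: Literature home (namespace `Literature.AlgebraicGeometry.HodgeTheory.CyclicCoverMonodromy.*`) of the declarations used by
the Carlson–Toledo discharge from the Summits-side `HodgeConjecture/Theorems/CyclicUnitaryPowersUninodalTernaryForm` and
`…/CyclicUnitaryPowersNodalMeridianExists` (route `CyclicUnitaryPowers`; imports `Literature/` and Mathlib only), which `Literature/`
may not import. Lane `lit-hodgefound`, seat p20.

## References

* [CarlsonToledo1999] J. A. Carlson, D. Toledo, *Discriminant complements and kernels of monodromy representations*, Duke Math.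
  J. 97 (1999), §1, §2, §6 (kdoublept).
* [VoisinHodgeII2003] C. Voisin, *Hodge Theory and Complex Algebraic Geometry II* (CUP 2003), §2.3.1 (ordinary double points),
  §2.3.2.
-/

/-! ## Part 1: The uninodal ternary form `x₀^{p-2}(x₁² + x₂²)`: homogeneity, gradient, Hessian, one node -/

noncomputable section

namespace Literature.AlgebraicGeometry.HodgeTheory.CyclicCoverMonodromy.UninodalTernaryForm

open MvPolynomial Literature.AlgebraicGeometry.Motives Literature.AlgebraicGeometry.HodgeTheory

/-- The witness is homogeneous of degree `m + 3`. [cite: CarlsonToledo1999, §6] -/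
theorem isHomogeneous_nodalTernaryForm (m : ℕ) : (X 2 ^ (m + 1) * (X 0 * X 1) + X 0 ^ (m + 3) + X 1 ^ (m + 3) : MvPolynomial (Fin 3) ℂ).IsHomogeneous (m + 3) := by
  have hX : ∀ i : Fin 3, (X i : MvPolynomial (Fin 3) ℂ).IsHomogeneous 1 := fun i => isHomogeneous_X ℂ i
  have hA : (X 2 ^ (m + 1) * (X 0 * X 1) : MvPolynomial (Fin 3) ℂ).IsHomogeneous (m + 3) := by
    have h := ((hX 2).pow (m + 1)).mul ((hX 0).mul (hX 1))
    rwa [show 1 * (m + 1) + (1 + 1) = m + 3 by ring] at h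
  have hB : ∀ i : Fin 3, (X i ^ (m + 3) : MvPolynomial (Fin 3) ℂ).IsHomogeneous (m + 3) := fun i => by
    simpa using (hX i).pow (m + 3)
  exact (hA.add (hB 0)).add (hB 1)

/-- The gradient of the witness (closed form of the three partial derivatives). [cite: CarlsonToledo1999, §6] -/
theorem pderiv_nodalTernaryForm (m : ℕ) :
    pderiv 0 (X 2 ^ (m + 1) * (X 0 * X 1) + X 0 ^ (m + 3) + X 1 ^ (m + 3) : MvPolynomial (Fin 3) ℂ) = X 2 ^ (m + 1) * X 1 + C ((m : ℂ) + 3) * X 0 ^ (m + 2) ∧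
    pderiv 1 (X 2 ^ (m + 1) * (X 0 * X 1) + X 0 ^ (m + 3) + X 1 ^ (m + 3) : MvPolynomial (Fin 3) ℂ) = X 2 ^ (m + 1) * X 0 + C ((m : ℂ) + 3) * X 1 ^ (m + 2) ∧
    pderiv 2 (X 2 ^ (m + 1) * (X 0 * X 1) + X 0 ^ (m + 3) + X 1 ^ (m + 3) : MvPolynomial (Fin 3) ℂ) = C ((m : ℂ) + 1) * X 2 ^ m * (X 0 * X 1) := by
  refine ⟨?_, ?_, ?_⟩
  · simp +decide only [map_add, Derivation.leibniz, Derivation.leibniz_pow, pderiv_X,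
      Pi.single_apply, smul_eq_mul, mul_zero, add_zero, Nat.add_succ_sub_one, if_true, if_false,
      nsmul_eq_mul, Nat.cast_add, Nat.cast_ofNat]
    simp only [map_natCast, map_ofNat]
    ring
  · simp +decide only [map_add, Derivation.leibniz, Derivation.leibniz_pow, pderiv_X,
      Pi.single_apply, smul_eq_mul, mul_zero, add_zero, Nat.add_succ_sub_one, if_true, if_false,
      nsmul_eq_mul, Nat.cast_add, Nat.cast_ofNat]
    simp only [map_natCast, map_ofNat]
    ring
  · simp +decide only [map_add, Derivation.leibniz, Derivation.leibniz_pow, pderiv_X,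
      Pi.single_apply, smul_eq_mul, mul_zero, add_zero, Nat.add_succ_sub_one, if_true, if_false,
      nsmul_eq_mul, Nat.cast_add, Nat.cast_ofNat]
    simp only [map_natCast, map_one, mul_one]
    ring

/-- The gradient of the witness as a vector of closed forms. [cite: CarlsonToledo1999, §6] -/
theorem pderiv_nodalTernaryForm_eq (m : ℕ) (j : Fin 3) :
    pderiv j (X 2 ^ (m + 1) * (X 0 * X 1) + X 0 ^ (m + 3) + X 1 ^ (m + 3) : MvPolynomial (Fin 3) ℂ) =
      (![X 2 ^ (m + 1) * X 1 + C ((m : ℂ) + 3) * X 0 ^ (m + 2),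
          X 2 ^ (m + 1) * X 0 + C ((m : ℂ) + 3) * X 1 ^ (m + 2),
          C ((m : ℂ) + 1) * X 2 ^ m * (X 0 * X 1)] : Fin 3 → MvPolynomial (Fin 3) ℂ) j := by
  obtain ⟨h0, h1, h2⟩ := pderiv_nodalTernaryForm m
  fin_cases j
  exacts [h0, h1, h2]

/-- The gradient of the witness vanishes at `e₂ = (0,0,1)`. [cite: CarlsonToledo1999, §6] -/
theorem eval_pderiv_nodalTernaryForm_e₂ (m : ℕ) (j : Fin 3) :
    eval (![0, 0, 1] : Fin 3 → ℂ) (pderiv j (X 2 ^ (m + 1) * (X 0 * X 1) + X 0 ^ (m + 3) + X 1 ^ (m + 3) : MvPolynomial (Fin 3) ℂ)) = 0 := by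
  rw [pderiv_nodalTernaryForm_eq m j]
  fin_cases j <;> simp

/-- **Rank `2` of a `3 × 3` matrix** from a non-zero kernel vector and a two-sided multiple equal to a diagonal
matrix whose diagonal vanishes at exactly one index. [cite: CarlsonToledo1999, §6] -/
theorem rank_eq_two {M A B : Matrix (Fin 3) (Fin 3) ℂ} {v : Fin 3 → ℂ} (hv : v ≠ 0)
    (hMv : M.mulVec v = 0) {w : Fin 3 → ℂ} (hw : A * M * B = Matrix.diagonal w) (k : Fin 3)
    (hk : ∀ i, w i = 0 ↔ i = k) : M.rank = 2 := by
  classical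
  apply le_antisymm
  · have h1 := LinearMap.finrank_range_add_finrank_ker M.mulVecLin
    rw [Module.finrank_fintype_fun_eq_card, Fintype.card_fin] at h1
    have hker : 1 ≤ Module.finrank ℂ (LinearMap.ker M.mulVecLin) := by
      rw [Nat.one_le_iff_ne_zero]
      intro h0
      rw [Submodule.finrank_eq_zero] at h0
      have : v ∈ LinearMap.ker M.mulVecLin := by
        rw [LinearMap.mem_ker, Matrix.mulVecLin_apply, hMv]
      rw [h0, Submodule.mem_bot] at this
      exact hv this
    change Module.finrank ℂ (LinearMap.range M.mulVecLin) ≤ 2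
    omega
  · have hcard : Fintype.card {i // w i ≠ 0} = 2 := by
      rw [Fintype.card_subtype]
      have hset : Finset.univ.filter (fun i : Fin 3 ↦ w i ≠ 0) = Finset.univ.erase k := by
        ext i
        simp only [Finset.mem_filter, Finset.mem_univ, true_and, Finset.mem_erase, ne_eq, hk, and_true]
      rw [hset, Finset.card_erase_of_mem (Finset.mem_univ k), Finset.card_univ, Fintype.card_fin]
    calc 2 = (Matrix.diagonal w).rank := by rw [Matrix.rank_diagonal, hcard]
      _ = (A * M * B).rank := by rw [hw]
      _ ≤ (A * M).rank := Matrix.rank_mul_le_left _ _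
      _ ≤ M.rank := Matrix.rank_mul_le_right _ _

/-- The Hessian of the witness at `e₂` has rank `2`. [cite: CarlsonToledo1999, §6] -/
theorem rank_hessian_nodalTernaryForm (m : ℕ) :
    (Matrix.of fun i j : Fin 3 => eval (![0, 0, 1] : Fin 3 → ℂ)
      (pderiv i (pderiv j (X 2 ^ (m + 1) * (X 0 * X 1) + X 0 ^ (m + 3) + X 1 ^ (m + 3) : MvPolynomial (Fin 3) ℂ)))).rank = 2 := by
  have hM : (Matrix.of fun i j : Fin 3 => eval (![0, 0, 1] : Fin 3 → ℂ)
      (pderiv i (pderiv j (X 2 ^ (m + 1) * (X 0 * X 1) + X 0 ^ (m + 3) + X 1 ^ (m + 3) : MvPolynomial (Fin 3) ℂ)))) = !![0, 1, 0; 1, 0, 0; 0, 0, 0] := by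
    ext i j
    rw [Matrix.of_apply, pderiv_nodalTernaryForm_eq m j]
    fin_cases i <;> fin_cases j <;> simp [Derivation.leibniz, Derivation.leibniz_pow, pderiv_X]
  rw [hM]
  refine rank_eq_two (v := ![0, 0, 1]) (A := 1) (B := !![0, 1, 0; 1, 0, 0; 0, 0, 0])
    (w := ![1, 1, 0]) (fun h => by simpa using congr_fun h 2) ?_ ?_ 2 ?_
  · ext i; fin_cases i <;> simp [Matrix.mulVec, dotProduct, Fin.sum_univ_three]
  · ext i j
    fin_cases i <;> fin_cases j <;> simp [Matrix.mul_apply, Fin.sum_univ_three]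
  · intro i; fin_cases i <;> simp

/-- `e₂` is an ordinary double point of the witness. [cite: VoisinHodgeII2003, §2.3.1] -/
theorem isOrdinaryDoublePointOf_nodalTernaryForm (m : ℕ) :
    IsOrdinaryDoublePointOf (n := 1) (X 2 ^ (m + 1) * (X 0 * X 1) + X 0 ^ (m + 3) + X 1 ^ (m + 3) : MvPolynomial (Fin 3) ℂ) ![0, 0, 1] :=
  ⟨fun h => by simpa using congr_fun h 2, eval_pderiv_nodalTernaryForm_e₂ m, rank_hessian_nodalTernaryForm m⟩

/-- A vector `z : Fin 3 → ℂ` is `t • q` as soon as all its coordinates agree with those of `t • q`. [cite: CarlsonToledo1999, §6] -/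
theorem eq_smul_of_apply_eq {z q : Fin 3 → ℂ} {t : ℂ} (h0 : z 0 = t * q 0) (h1 : z 1 = t * q 1)
    (h2 : z 2 = t * q 2) : z = t • q := by
  funext i
  fin_cases i
  · simpa using h0
  · simpa using h1
  · simpa using h2

/-- **Uniqueness of the singular point of the witness**: a non-zero `z` at which the gradient vanishes is a
multiple of `e₂`. [cite: CarlsonToledo1999, §6] -/
theorem eq_smul_of_grad_nodalTernaryForm (m : ℕ) (z : Fin 3 → ℂ) (hz : z ≠ 0)
    (hgrad : ∀ j, eval z (pderiv j (X 2 ^ (m + 1) * (X 0 * X 1) + X 0 ^ (m + 3) + X 1 ^ (m + 3) : MvPolynomial (Fin 3) ℂ)) = 0) :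
    z = z 2 • (![0, 0, 1] : Fin 3 → ℂ) := by
  have hd : ((m : ℂ) + 3) ≠ 0 := by exact_mod_cast Nat.succ_ne_zero (m + 2)
  have hd1 : ((m : ℂ) + 1) ≠ 0 := by exact_mod_cast Nat.succ_ne_zero m
  have hg : ∀ j, eval z ((![X 2 ^ (m + 1) * X 1 + C ((m : ℂ) + 3) * X 0 ^ (m + 2),
          X 2 ^ (m + 1) * X 0 + C ((m : ℂ) + 3) * X 1 ^ (m + 2),
          C ((m : ℂ) + 1) * X 2 ^ m * (X 0 * X 1)] : Fin 3 → MvPolynomial (Fin 3) ℂ) j) = 0 :=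
    fun j => by rw [← pderiv_nodalTernaryForm_eq m j]; exact hgrad j
  have g0 := hg 0
  have g1 := hg 1
  have g2 := hg 2
  simp only [Matrix.cons_val_zero, Matrix.cons_val_one, Matrix.cons_val_two,
    Matrix.head_cons, Matrix.tail_cons, map_add, map_mul, map_pow, eval_X, eval_C] at g0 g1 g2
  by_cases hz2 : z 2 = 0
  · exfalso
    apply hz
    rw [hz2, zero_pow (Nat.succ_ne_zero _), zero_mul, zero_add] at g0 g1
    have e0 : z 0 = 0 := (pow_eq_zero_iff (Nat.succ_ne_zero _)).1 ((mul_eq_zero.1 g0).resolve_left hd)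
    have e1 : z 1 = 0 := (pow_eq_zero_iff (Nat.succ_ne_zero _)).1 ((mul_eq_zero.1 g1).resolve_left hd)
    funext i
    fin_cases i <;> simp [e0, e1, hz2]
  · have hs : z 0 * z 1 = 0 :=
      (mul_eq_zero.1 g2).resolve_left (mul_ne_zero hd1 (pow_ne_zero _ hz2))
    have hw : z 2 ^ (m + 1) ≠ 0 := pow_ne_zero _ hz2
    rcases mul_eq_zero.1 hs with e0 | e1
    · -- `z₀ = 0`, then `∂₀` gives `z₁ = 0`
      rw [e0, zero_pow (Nat.succ_ne_zero _), mul_zero, add_zero] at g0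
      have e1 : z 1 = 0 := (mul_eq_zero.1 g0).resolve_left hw
      exact eq_smul_of_apply_eq (by simp [e0]) (by simp [e1]) (by simp)
    · -- `z₁ = 0`, then `∂₁` gives `z₀ = 0`
      rw [e1, zero_pow (Nat.succ_ne_zero _), mul_zero, add_zero] at g1
      have e0 : z 0 = 0 := (mul_eq_zero.1 g1).resolve_left hw
      exact eq_smul_of_apply_eq (by simp [e0]) (by simp [e1]) (by simp)

/-- **The witness is nodal with the single node `e₂ = [0:0:1]`.** [cite: VoisinHodgeII2003, §2.3.1] -/
theorem isNodalFormWithNodes_nodalTernaryForm (m : ℕ) :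
    IsNodalFormWithNodes (n := 1) (X 2 ^ (m + 1) * (X 0 * X 1) + X 0 ^ (m + 3) + X 1 ^ (m + 3) : MvPolynomial (Fin 3) ℂ) ![(![0, 0, 1] : Fin 3 → ℂ)] := by
  refine ⟨fun i => ?_, fun i i' _ => Subsingleton.elim i i', fun z hz hgrad => ⟨0, z 2, ?_⟩⟩
  · rw [Matrix.cons_val_fin_one]
    exact isOrdinaryDoublePointOf_nodalTernaryForm m
  · rw [Matrix.cons_val_fin_one]
    exact eq_smul_of_grad_nodalTernaryForm m z hz hgrad

end Literature.AlgebraicGeometry.HodgeTheory.CyclicCoverMonodromy.UninodalTernaryForm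

end

/-! ## Part 2: Singular coefficient vectors and the discriminant equation -/

noncomputable section

open MvPolynomial _root_.Topology _root_.Filter
open Literature.AlgebraicGeometry.Motives Literature.AlgebraicGeometry.Motives.UniversalHypersurface
open Literature.AlgebraicGeometry.HodgeTheory Literature.AlgebraicGeometry.HodgeTheory.DiscriminantBranches
open Literature.AlgebraicGeometry.FundamentalGroup
open Literature.NumberTheory.Transcendental (hasFDerivAt_eval)
open Literature.AlgebraicGeometry.HodgeTheory.CyclicCoverMonodromy.UninodalTernaryForm

namespace Literature.AlgebraicGeometry.HodgeTheory.CyclicCoverMonodromy.NodalMeridianExists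

/-! ### §1 The discriminant of the cyclic family is the discriminant of ternary forms -/

/-- The tree's `formOfCoeffs` for plane curves of degree `p` (`n = 1`) is the ternary form `Σ_e b_e x^e`
(same index type `{e : Fin 3 →₀ ℕ // |e| = p}`). [cite: CarlsonToledo1999, §6] -/
theorem formOfCoeffs_eq_sum {p : ℕ} (b : TernaryIndex p → ℂ) :
    formOfCoeffs (n := 1) (d := p) b = ∑ e : TernaryIndex p, monomial e.1 (b e) := rfl

/-- An equation of the discriminant of the cyclic family (`x₃^p − f_b` singular) is an equation of the discriminant
of ternary `p`-forms (`V(f_b)` singular, `singularCoeffs 1 p`), `p ≥ 2`. [cite: CarlsonToledo1999, §2 (held text p0004)] -/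
theorem mem_singularCoeffs_iff_of_isDiscriminantEquation {p : ℕ} (hp : 2 ≤ p) {D : MvPolynomial (TernaryIndex p) ℂ}
    (hDeq : IsDiscriminantEquation p D) (a : DegIndex 1 p → ℂ) : a ∈ singularCoeffs 1 p ↔ eval a D = 0 := by
  rw [hDeq a, mem_singularCoeffs_iff, formOfCoeffs_eq_sum, isNonsingularForm_cyclicCoverForm_iff hp]

/-! ### §2 The gradient of the discriminant at a one-nodal form -/

/-- A one-nodal form is singular: its coefficient vector lies on the discriminant. [cite: VoisinHodgeII2003, §2.3.1] -/
theorem coeffsOf_mem_singularCoeffs_of_uninodal {n d : ℕ} (hd : 1 ≤ d) {f₁ : MvPolynomial (Fin (n + 2)) ℂ}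
    (hf₁ : f₁.IsHomogeneous d) {x : Fin (n + 2) → ℂ} (hnod : IsNodalFormWithNodes f₁ ![x]) :
    coeffsOf n d f₁ ∈ singularCoeffs n d := by
  rw [mem_singularCoeffs_iff_exists]
  refine ⟨x, (hnod.1 0).ne_zero, ?_, fun j => ?_⟩
  · rw [formOfCoeffs_coeffsOf _ _ hf₁]; exact (hnod.1 0).eval_eq_zero hf₁ hd
  · rw [formOfCoeffs_coeffsOf _ _ hf₁]; exact (hnod.1 0).eval_pderiv j

/-! ### §3 A meridian centred at a one-nodal curve -/

section Meridians

variable {ι : Type} [Fintype ι] {m : ℕ} {h : Fin m → MvPolynomial ι ℂ}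
  {s : affineHypersurfaceComplement h} {j : Fin m}

end Meridians

end Literature.AlgebraicGeometry.HodgeTheory.CyclicCoverMonodromy.NodalMeridianExists

end
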